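import Mathlib
import Summits.AtomisticToContinuum.Crystallization.Theorems.GappedShellCensusCleanLimitsHaveWindowsCleanChartLocal
import Summits.AtomisticToContinuum.Crystallization.Theorems.GappedShellCensusCleanLimitsHaveWindowsCleanChartTransfer
import Summits.AtomisticToContinuum.Crystallization.Theorems.PalmUnimodularRigidityShellsToBarlowChartCubicGrowthAngle

/-!
# `CleanLimitsHaveWindows` (stmt-AtomisticToContinuum-15932), line `Sketch` — helper for stub K1
# (`stub_cleanChart`): integer charts, directions and the clean-chart hypothesis of a clean set

Stub K1 is proved by re-running the development of the crux `ShellsToBarlowChart` (route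
`PalmUnimodularRigidity`) on clean charts, at the scale `b = 56/51` for which "bonded" (`dist ≤ 1.02 b`)
is "distance in `(0, 28/25]`".  This file manufactures, for an everywhere-clean torn-free set `S` at scale
`b`, the three inputs of that re-run from the local chart `cleanChart_local` (file `…CleanChartLocal`):

* `clean_intChart` — at every site an INTEGER chart: pattern `fcc3Int`/`hcpInt`, a linear isometry `A`,
  a labelling `nb` of the bonded neighbours, bijective, each label within `b/5` of its ideal position
  `x + (b/√18) A t`, bonds among neighbours = label pairs at squared distance `18`;
* `clean_direction` — for every direction some bonded neighbour has inner product `≥ 0.556 ‖d‖` with it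
  (covering angle `45°` of both patterns, `fcc_coveringAngle`/`hcp_coveringAngle`, minus the matching
  error `b/5`);
* `clean_charts` — a choice of integer charts at all sites satisfying the CLEAN-CHART hypothesis of the
  re-run development (`….Clean.*`), the transfer clause being `transfer_of_close`.
-/

noncomputable section

namespace Summit.AtomisticToContinuum.Crystallization.Theorems.CleanHull

open Literature.Geometry.DiscreteGeometry
open Summit.AtomisticToContinuum.Crystallization.Theorems.PalmUnimodularRigidityShellsToBarlowChart
open Summit.AtomisticToContinuum.Crystallization.Theorems.ShellsToBarlowChartNegative

section Charts

variable {S : Set (EuclideanSpace ℝ (Fin 3))}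

/-- **Integer chart at a site of a clean torn-free set at scale `56/51`.** [folklore] -/
theorem clean_intChart
    (hclean : ∀ y ∈ S, ({w ∈ S | w ≠ y ∧ dist y w ≤ 56 / 51 * (1 + 1 / 50)}.ncard = 12 ∧
        ∀ w ∈ S, w ≠ y → 56 / 51 * (1 - 1 / 50) ≤ dist y w ∧
          (dist y w ≤ 56 / 51 * (1 + 1 / 50) ∨ 56 / 51 * (63 / 50) ≤ dist y w)) ∧
      ∃ T : Finset (EuclideanSpace ℝ (Fin 3)), (↑T : Set (EuclideanSpace ℝ (Fin 3))) =
          (fun w => (56 / 51 : ℝ)⁻¹ • (w - y)) '' {w ∈ S | w ≠ y ∧ dist y w ≤ 56 / 51 * (1 + 1 / 50)} ∧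
        (ShellCloseTo (1 / 5) T fccKissingPattern ∨ ShellCloseTo (1 / 5) T hcpKissingPattern))
    (htorn : ∀ y ∈ S, ∀ v ∈ S, v ≠ y → dist y v ≤ 56 / 51 * (1 + 1 / 50) →
      4 ≤ {w ∈ S | w ≠ y ∧ w ≠ v ∧ dist y w ≤ 56 / 51 * (1 + 1 / 50) ∧ dist v w ≤ 56 / 51 * (1 + 1 / 50)}.ncard)
    {x : EuclideanSpace ℝ (Fin 3)} (hx : x ∈ S) :
    ∃ (P : Finset (Fin 3 → ℤ)) (A : EuclideanSpace ℝ (Fin 3) →ₗᵢ[ℝ] EuclideanSpace ℝ (Fin 3))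
      (nb : (Fin 3 → ℤ) → EuclideanSpace ℝ (Fin 3)),
      (P = fcc3Int ∨ P = hcpInt) ∧
      Set.BijOn nb (↑P : Set (Fin 3 → ℤ)) {y | y ∈ S ∧ (0 < dist x y ∧ dist x y ≤ 28 / 25)} ∧
      (∀ t ∈ P, dist (nb t) (x + ((56 / 51 : ℝ) * (Real.sqrt 18)⁻¹) • A (intVec t)) ≤ (56 / 51 : ℝ) / 5) ∧
      (∀ t ∈ P, ∀ t' ∈ P,
        ((0 < dist (nb t) (nb t') ∧ dist (nb t) (nb t') ≤ 28 / 25) ↔ sqNormInt (t - t') = 18)) := by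
  classical
  obtain ⟨Pr, A, φ, hPr, hbij, hclose, hlink⟩ :=
    cleanChart_local (Z := S) (a := 56 / 51) (by norm_num) hclean htorn hx
  -- the integer pattern behind `Pr`
  obtain ⟨P, hP, hPrP⟩ : ∃ P : Finset (Fin 3 → ℤ), (P = fcc3Int ∨ P = hcpInt) ∧ Pr = scaledPattern P 18 := by
    rcases hPr with rfl | rfl
    · exact ⟨fcc3Int, Or.inl rfl, fccKissingPattern_eq_scaledPattern_fcc3Int⟩
    · exact ⟨hcpInt, Or.inr rfl, hcpKissingPattern_eq_scaledPattern_hcpInt⟩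
  set sc : (Fin 3 → ℤ) → EuclideanSpace ℝ (Fin 3) := fun t => (Real.sqrt 18)⁻¹ • intVec t with hsc
  have hPr_coe : (↑Pr : Set (EuclideanSpace ℝ (Fin 3))) = sc '' ↑P := by
    rw [hPrP, scaledPattern, Finset.coe_image]
    rfl
  have hsc_mem : ∀ t ∈ P, sc t ∈ Pr := fun t ht => by
    rw [hPrP, scaledPattern]; exact Finset.mem_image_of_mem _ ht
  have hsc_bij : Set.BijOn sc ↑P ↑Pr := by
    rw [hPr_coe]
    exact ⟨Set.mapsTo_image _ _, scale18_injective.injOn, Set.surjOn_image _ _⟩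
  -- the bond set of the stub is the window-bond set
  have hwin : {w ∈ S | w ≠ x ∧ dist x w ≤ 56 / 51 * (1 + 1 / 50)} =
      {y | y ∈ S ∧ (0 < dist x y ∧ dist x y ≤ 28 / 25)} := by
    ext w
    simp only [Set.mem_setOf_eq]
    constructor
    · rintro ⟨hw, hne, hd⟩
      exact ⟨hw, dist_pos.2 (Ne.symm hne), by norm_num at hd; linarith⟩
    · rintro ⟨hw, hpos, hd⟩
      exact ⟨hw, fun h => by rw [h, dist_self] at hpos; exact lt_irrefl _ hpos, by norm_num; linarith⟩
  refine ⟨P, A, φ ∘ sc, hP, ?_, ?_, ?_⟩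
  · rw [← hwin]
    exact hbij.comp hsc_bij
  · intro t ht
    have h := hclose (sc t) (hsc_mem t ht)
    have e : (56 / 51 : ℝ) • A (sc t) = ((56 / 51 : ℝ) * (Real.sqrt 18)⁻¹) • A (intVec t) := by
      simp only [hsc, LinearIsometry.map_smul, smul_smul]
    simp only [Function.comp]
    rw [← e]
    linarith
  · intro t ht t' ht'
    simp only [Function.comp]
    by_cases htt : t = t'
    · subst htt
      simp only [dist_self, lt_self_iff_false, false_and, sub_self, false_iff]
      decide
    · have hne : sc t ≠ sc t' := fun h => htt (scale18_injective h)
      have h1 := hlink (sc t) (hsc_mem t ht) (sc t') (hsc_mem t' ht') hne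
      rw [show (56 / 51 : ℝ) * (1 + 1 / 50) = 28 / 25 by norm_num] at h1
      rw [← dist_scale18_eq_one_iff, ← h1]
      have hpos : 0 < dist (φ (sc t)) (φ (sc t')) := by
        refine dist_pos.2 fun h => hne (hbij.injOn (hsc_mem t ht) (hsc_mem t' ht') h)
      exact ⟨fun h => h.2, fun h => ⟨hpos, h⟩⟩

/-- **Directions.** At every site of a clean torn-free set at scale `56/51`, for every vector `d` some
bonded neighbour `y` has `⟪y − x, d⟫ ≥ 0.556 ‖d‖`. [folklore] -/
theorem clean_direction
    (hclean : ∀ y ∈ S, ({w ∈ S | w ≠ y ∧ dist y w ≤ 56 / 51 * (1 + 1 / 50)}.ncard = 12 ∧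
        ∀ w ∈ S, w ≠ y → 56 / 51 * (1 - 1 / 50) ≤ dist y w ∧
          (dist y w ≤ 56 / 51 * (1 + 1 / 50) ∨ 56 / 51 * (63 / 50) ≤ dist y w)) ∧
      ∃ T : Finset (EuclideanSpace ℝ (Fin 3)), (↑T : Set (EuclideanSpace ℝ (Fin 3))) =
          (fun w => (56 / 51 : ℝ)⁻¹ • (w - y)) '' {w ∈ S | w ≠ y ∧ dist y w ≤ 56 / 51 * (1 + 1 / 50)} ∧
        (ShellCloseTo (1 / 5) T fccKissingPattern ∨ ShellCloseTo (1 / 5) T hcpKissingPattern))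
    (htorn : ∀ y ∈ S, ∀ v ∈ S, v ≠ y → dist y v ≤ 56 / 51 * (1 + 1 / 50) →
      4 ≤ {w ∈ S | w ≠ y ∧ w ≠ v ∧ dist y w ≤ 56 / 51 * (1 + 1 / 50) ∧ dist v w ≤ 56 / 51 * (1 + 1 / 50)}.ncard) :
    ∀ x ∈ S, ∀ d : EuclideanSpace ℝ (Fin 3), ∃ y ∈ S, y ≠ x ∧ dist x y ≤ 28 / 25 ∧
      139 / 250 * ‖d‖ ≤ inner ℝ (y - x) d := by
  intro x hx d
  obtain ⟨Pr, A, φ, hPr, hbij, hclose, -⟩ :=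
    cleanChart_local (Z := S) (a := 56 / 51) (by norm_num) hclean htorn hx
  -- unit pattern with covering angle `45°`
  have hcov : ∀ u : EuclideanSpace ℝ (Fin 3), ∃ v ∈ Pr, ‖u‖ ≤ Real.sqrt 2 * inner ℝ u v := by
    rcases hPr with rfl | rfl
    · exact fcc_coveringAngle
    · exact hcp_coveringAngle
  -- a preimage direction `d'` with `A d' = d`
  obtain ⟨d', hd'⟩ : ∃ d' : EuclideanSpace ℝ (Fin 3), A d' = d :=
    ⟨(A.toLinearIsometryEquiv rfl).symm d, by
      rw [← LinearIsometry.coe_toLinearIsometryEquiv A rfl]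
      exact (A.toLinearIsometryEquiv rfl).apply_symm_apply d⟩
  have hnd : ‖d'‖ = ‖d‖ := by rw [← hd', LinearIsometry.norm_map]
  obtain ⟨v, hv, hcv⟩ := hcov d'
  obtain ⟨hyS, hyne, hyd⟩ := hbij.mapsTo hv
  refine ⟨φ v, hyS, hyne, by norm_num at hyd; linarith, ?_⟩
  have h1 : dist (φ v) (x + (56 / 51 : ℝ) • A v) ≤ (56 / 51 : ℝ) / 5 := hclose v hv
  have hinner : inner ℝ ((56 / 51 : ℝ) • A v) d = 56 / 51 * inner ℝ d' v := by
    rw [← hd', real_inner_smul_left, LinearIsometry.inner_map_map, real_inner_comm]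
  have hI0 : 0 ≤ inner ℝ d' v :=
    (mul_nonneg_iff_of_pos_left (by positivity)).1 ((norm_nonneg d').trans hcv)
  have hI : 707 / 1000 * ‖d‖ ≤ inner ℝ d' v := by
    have h2 : ‖d'‖ ≤ 14143 / 10000 * inner ℝ d' v :=
      hcv.trans (mul_le_mul_of_nonneg_right sqrt_two_lt'.le hI0)
    rw [hnd] at h2
    linarith
  have herr : |inner ℝ (φ v - x - (56 / 51 : ℝ) • A v) d| ≤ (56 / 51 : ℝ) / 5 * ‖d‖ := by
    refine (abs_real_inner_le_norm _ _).trans (mul_le_mul_of_nonneg_right ?_ (norm_nonneg _))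
    have e : φ v - x - (56 / 51 : ℝ) • A v = φ v - (x + (56 / 51 : ℝ) • A v) := by abel
    rw [e, ← dist_eq_norm]
    exact h1
  have hsplit : inner ℝ (φ v - x) d =
      inner ℝ ((56 / 51 : ℝ) • A v) d + inner ℝ (φ v - x - (56 / 51 : ℝ) • A v) d := by
    rw [inner_sub_left (φ v - x)]; ring
  rw [hsplit, hinner]
  rw [abs_le] at herr
  nlinarith [herr.1, norm_nonneg d]

/-- **The clean-chart hypothesis of the re-run development holds for a clean torn-free set at scale
`56/51`**: integer charts everywhere (a choice) with the transfer property across every bond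
(`transfer_of_close`). [folklore] -/
theorem clean_charts
    (hclean : ∀ y ∈ S, ({w ∈ S | w ≠ y ∧ dist y w ≤ 56 / 51 * (1 + 1 / 50)}.ncard = 12 ∧
        ∀ w ∈ S, w ≠ y → 56 / 51 * (1 - 1 / 50) ≤ dist y w ∧
          (dist y w ≤ 56 / 51 * (1 + 1 / 50) ∨ 56 / 51 * (63 / 50) ≤ dist y w)) ∧
      ∃ T : Finset (EuclideanSpace ℝ (Fin 3)), (↑T : Set (EuclideanSpace ℝ (Fin 3))) =
          (fun w => (56 / 51 : ℝ)⁻¹ • (w - y)) '' {w ∈ S | w ≠ y ∧ dist y w ≤ 56 / 51 * (1 + 1 / 50)} ∧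
        (ShellCloseTo (1 / 5) T fccKissingPattern ∨ ShellCloseTo (1 / 5) T hcpKissingPattern))
    (htorn : ∀ y ∈ S, ∀ v ∈ S, v ≠ y → dist y v ≤ 56 / 51 * (1 + 1 / 50) →
      4 ≤ {w ∈ S | w ≠ y ∧ w ≠ v ∧ dist y w ≤ 56 / 51 * (1 + 1 / 50) ∧ dist v w ≤ 56 / 51 * (1 + 1 / 50)}.ncard) :
    ∃ (Pc : EuclideanSpace ℝ (Fin 3) → Finset (Fin 3 → ℤ))
      (nb : EuclideanSpace ℝ (Fin 3) → (Fin 3 → ℤ) → EuclideanSpace ℝ (Fin 3)),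
      (∀ z ∈ S, (Pc z = fcc3Int ∨ Pc z = hcpInt) ∧
        Set.BijOn (nb z) (↑(Pc z) : Set (Fin 3 → ℤ)) {y | y ∈ S ∧ (0 < dist z y ∧ dist z y ≤ 28 / 25)} ∧
        (∀ t ∈ Pc z, ∀ t' ∈ Pc z, ((0 < dist (nb z t) (nb z t') ∧ dist (nb z t) (nb z t') ≤ 28 / 25) ↔
          sqNormInt (t - t') = 18))) ∧
      (∀ x ∈ S, ∀ y ∈ S, (0 < dist x y ∧ dist x y ≤ 28 / 25) → ∀ t ∈ Pc x, ∀ t' ∈ Pc x, ∀ u ∈ Pc y, ∀ u' ∈ Pc y,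
        nb y u = nb x t → nb y u' = nb x t' → sqNormInt (u - u') = sqNormInt (t - t')) := by
  classical
  have hch0 : ∀ x : EuclideanSpace ℝ (Fin 3), ∃ (P : Finset (Fin 3 → ℤ))
      (A : EuclideanSpace ℝ (Fin 3) →ₗᵢ[ℝ] EuclideanSpace ℝ (Fin 3)) (nb : (Fin 3 → ℤ) → EuclideanSpace ℝ (Fin 3)),
      x ∈ S → (P = fcc3Int ∨ P = hcpInt) ∧
        Set.BijOn nb (↑P : Set (Fin 3 → ℤ)) {y | y ∈ S ∧ (0 < dist x y ∧ dist x y ≤ 28 / 25)} ∧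
        (∀ t ∈ P, dist (nb t) (x + ((56 / 51 : ℝ) * (Real.sqrt 18)⁻¹) • A (intVec t)) ≤ (56 / 51 : ℝ) / 5) ∧
        (∀ t ∈ P, ∀ t' ∈ P,
          ((0 < dist (nb t) (nb t') ∧ dist (nb t) (nb t') ≤ 28 / 25) ↔ sqNormInt (t - t') = 18)) := by
    intro x
    by_cases hx : x ∈ S
    · obtain ⟨P, A, nb, h⟩ := clean_intChart hclean htorn hx
      exact ⟨P, A, nb, fun _ => h⟩
    · exact ⟨∅, LinearIsometry.id, fun _ => 0, fun h => (hx h).elim⟩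
  choose Pc Ac nb hch using hch0
  refine ⟨Pc, nb, fun z hz => ⟨(hch z hz).1, (hch z hz).2.1, (hch z hz).2.2.2⟩, ?_⟩
  intro x hx y hy hxy t ht t' ht' u hu u' hu' hut hut'
  exact transfer_of_close (b := 56 / 51) (by norm_num) hx hy hxy (hch x hx).1 (hch x hx).2.1 (hch x hx).2.2.1
    (hch x hx).2.2.2 (hch y hy).1 (hch y hy).2.1 (hch y hy).2.2.1 (hch y hy).2.2.2 ht ht' hu hu' hut hut'

end Charts

end Summit.AtomisticToContinuum.Crystallization.Theorems.CleanHull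

end
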